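import Mathlib
import Summits.NavierStokesRegularity.NavierStokesRegularity.Theorems.SubOnsagerCeilingKPSharedPocketBarrier
import Summits.NavierStokesRegularity.NavierStokesRegularity.Theorems.OrthantWakeOrthantTableStructure
import HarnessLib

/-!
# The class-wide starvation corner is NOT VACUOUS on a new architecture: the uniform 3-CYCLE with a shared dead-end pocket
# (helper file for the crux `SubOnsagerCeiling.ForwardTailCeilingKP`, stmt-NavierStokesRegularity-27057, `--supports`)

Companion of `Theorems/SubOnsagerCeilingKPSharedPocket{Starvation,Barrier}.lean`.  The table below is the uniform KP 3-cycle
`0 → 1 → 2 → 0` (forward weights `1/2`) in which every live mode pumps in-shell into the dead-end pocket `3` (weights `1`): a RECURRENT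
permutation architecture (so far covered, WITHOUT exits, only at `b ≥ 1.34` by the strand-transfer rungs) that the shared-pocket theorem
covers at EVERY scale ratio `1 + ε₀ ∈ (1, 2]` (`ρ = κ = 2`, `ρκ = 4 > ε₀`).  The file checks that it lies inside the crux's hypotheses
(symmetric (4.2), cancelling (4.3), `4`-comparable, ORTHANT, diagonal feeds) and instantiates `sharedPocket_shellBarrierAt` on it:
`threeCyclePocket_nonempty_shellBarrierAt`.
HONEST FRAMING: MODEL lattice algebra (route SubOnsagerCeiling, rung TL-M2Break); no stub, crux or summit is proved and nothing here bears
on Navier–Stokes regularity. [cite: Tao2016AveragedNS, §4 (4.2)–(4.3)]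
-/

noncomputable section

-- the sub-problem namespace `NavierStokesRegularity.NavierStokesRegularity` is the tree's layout (D-0017)
set_option linter.dupNamespace false

namespace Summit.NavierStokesRegularity.NavierStokesRegularity.Theorems

open Literature.Analysis.FluidPDE.TaoCascade
open Summit.NavierStokesRegularity.NavierStokesRegularity.Theorems.SubOnsagerCeiling

section ThreeCyclePocket

variable {α : Fin 4 → Fin 4 → Fin 4 → ℤ × ℤ × ℤ → ℝ}
  (hfeed : ∀ i₁ i₂ i₃ : Fin 4, α i₁ i₂ i₃ ((0 : ℤ), (0 : ℤ), (1 : ℤ)) =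
      if i₁ = i₂ ∧ ((i₁ = 0 ∧ i₃ = 1) ∨ (i₁ = 1 ∧ i₃ = 2) ∨ (i₁ = 2 ∧ i₃ = 0)) then (1 / 2 : ℝ) else 0)
  (hup1 : ∀ i₁ i₂ i₃ : Fin 4, α i₁ i₂ i₃ ((1 : ℤ), (0 : ℤ), (0 : ℤ)) =
      if i₂ = i₃ ∧ ((i₂ = 0 ∧ i₁ = 1) ∨ (i₂ = 1 ∧ i₁ = 2) ∨ (i₂ = 2 ∧ i₁ = 0)) then (-(1 / 4) : ℝ) else 0)
  (hup2 : ∀ i₁ i₂ i₃ : Fin 4, α i₁ i₂ i₃ ((0 : ℤ), (1 : ℤ), (0 : ℤ)) =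
      if i₁ = i₃ ∧ ((i₁ = 0 ∧ i₂ = 1) ∨ (i₁ = 1 ∧ i₂ = 2) ∨ (i₁ = 2 ∧ i₂ = 0)) then (-(1 / 4) : ℝ) else 0)
  (hin : ∀ i₁ i₂ i₃ : Fin 4, α i₁ i₂ i₃ ((0 : ℤ), (0 : ℤ), (0 : ℤ)) =
      (if i₁ = i₂ ∧ i₁ ≠ 3 ∧ i₃ = 3 then (1 : ℝ) else 0) + (if i₂ = 3 ∧ i₃ = i₁ ∧ i₁ ≠ 3 then -(1 / 2) else 0) +
        (if i₁ = 3 ∧ i₃ = i₂ ∧ i₂ ≠ 3 then -(1 / 2) else 0))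
include hfeed hup1 hup2 hin

/-- Symmetry (4.2) and cancellation (4.3) of the 3-cycle-with-pocket table. [this file] -/
theorem threeCyclePocket_symmCanc : IsSymmetricCoeff α ∧ IsCancellingCoeff α := by
  constructor
  · intro i₁ i₂ i₃ μ₁ μ₂ μ₃ hμ
    rw [mem_shiftSet_iff] at hμ
    simp only [Prod.mk.injEq] at hμ
    rcases hμ with ⟨rfl, rfl, rfl⟩ | ⟨rfl, rfl, rfl⟩ | ⟨rfl, rfl, rfl⟩ | ⟨rfl, rfl, rfl⟩
    · simp only [hin]
      fin_cases i₁ <;> fin_cases i₂ <;> fin_cases i₃ <;> simp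
    · simp only [hup1, hup2]
    · simp only [hup1, hup2]
    · simp only [hfeed]
      fin_cases i₁ <;> fin_cases i₂ <;> fin_cases i₃ <;> simp
  · intro i₁ i₂ i₃ μ₁ μ₂ μ₃ hμ
    rw [mem_shiftSet_iff] at hμ
    simp only [Prod.mk.injEq] at hμ
    rcases hμ with ⟨rfl, rfl, rfl⟩ | ⟨rfl, rfl, rfl⟩ | ⟨rfl, rfl, rfl⟩ | ⟨rfl, rfl, rfl⟩ <;>
      simp only [hin, hfeed, hup1, hup2] <;>
      fin_cases i₁ <;> fin_cases i₂ <;> fin_cases i₃ <;> simp <;> norm_num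

/-- `4`-comparability of the 3-cycle-with-pocket table. [this file] -/
theorem threeCyclePocket_comparable : IsComparableCoeff 4 α ∧ True := by
  refine ⟨?_, trivial⟩
  intro i₁ i₂ i₃ μ hμ
  rw [mem_shiftSet_iff] at hμ
  rcases hμ with rfl | rfl | rfl | rfl <;>
    simp only [hin, hfeed, hup1, hup2] <;>
    fin_cases i₁ <;> fin_cases i₂ <;> fin_cases i₃ <;> simp <;> norm_num

/-- The orthant (Kamke) hypothesis of the crux for the 3-cycle-with-pocket table, via `orthant_iff_coefficients`. [this file] -/
theorem threeCyclePocket_orthant :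
    (∀ (Y : Fin 4 → ℤ → ℝ → ℝ) (τ : ℝ), (∀ (j : Fin 4) (k : ℤ), 1 ≤ k → 0 ≤ Y j k τ) →
      ∀ δ : ℝ, 0 < δ → ∀ (i : Fin 4) (n : ℤ), 1 ≤ n → Y i n τ = 0 → 0 ≤ quadTerm δ α Y i n τ) ∧ True := by
  refine ⟨?_, trivial⟩
  rw [orthant_iff_coefficients]
  refine ⟨?_, ?_, ?_⟩
  · intro i y
    simp only [hfeed, Fin.sum_univ_four]
    fin_cases i
    · simp
      exact mul_self_nonneg _
    · simp
      exact mul_self_nonneg _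
    · simp
      exact mul_self_nonneg _
    · simp
  · intro i a b hbi
    simp only [hup1, hup2]
    fin_cases i <;> fin_cases a <;> fin_cases b <;> simp at hbi ⊢
  · intro i y hy hyi
    simp only [hin, Fin.sum_univ_four]
    fin_cases i
    · have h0 : y 0 = 0 := hyi
      simp [h0]
    · have h1 : y 1 = 0 := hyi
      simp [h1]
    · have h2 : y 2 = 0 := hyi
      simp [h2]
    · simp
      nlinarith [mul_self_nonneg (y 0), mul_self_nonneg (y 1), mul_self_nonneg (y 2)]

omit hup1 hup2 in
/-- The shared-pocket class hypotheses of the 3-cycle-with-pocket table (`P = (1,1,1,0)`, `ρ = κ = 2`). [this file] -/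
theorem threeCyclePocket_classHyps :
    (∀ a b i : Fin 4, a ≠ b → α a b i (0, 0, 1) = 0) ∧ (∀ a : Fin 4, α a a 3 (0, 0, 1) = 0) ∧
      (∀ e : Fin 4, α 3 3 e (0, 0, 1) = 0) ∧
      (∀ a d : Fin 4, a ≠ d → α a a d (0, 0, 0) = if d = 3 then (![1, 1, 1, 0] : Fin 4 → ℝ) a else 0) ∧
      (∀ a b d : Fin 4, a ≠ b → a ≠ d → b ≠ d → α a b d (0, 0, 0) = 0) ∧
      (∀ a e : Fin 4, (2 : ℝ) * α a a e (0, 0, 1) ≤ (![1, 1, 1, 0] : Fin 4 → ℝ) a) ∧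
      (∀ a : Fin 4, (2 : ℝ) * ∑ e, α a a e (0, 0, 1) ≤ (![1, 1, 1, 0] : Fin 4 → ℝ) a) ∧
      (∀ a : Fin 4, a ≠ 3 → ∃ e : Fin 4, e ≠ 3 ∧ α a a e (0, 0, 1) ≠ 0) := by
  refine ⟨?_, ?_, ?_, ?_, ?_, ?_, ?_, ?_⟩
  · intro a b i hab
    rw [hfeed]
    simp [hab]
  · intro a
    rw [hfeed]
    fin_cases a <;> simp
  · intro e
    rw [hfeed]
    fin_cases e <;> simp
  · intro a d had
    rw [hin]
    fin_cases a <;> fin_cases d <;> simp at had ⊢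
  · intro a b d hab had hbd
    rw [hin]
    fin_cases a <;> fin_cases b <;> fin_cases d <;> simp at hab had hbd ⊢
  · intro a e
    rw [hfeed]
    fin_cases a <;> fin_cases e <;> simp
  · intro a
    simp only [hfeed, Fin.sum_univ_four]
    fin_cases a <;> simp
  · intro a ha
    fin_cases a
    · exact ⟨1, by decide, by rw [hfeed]; simp⟩
    · exact ⟨2, by decide, by rw [hfeed]; simp⟩
    · exact ⟨0, by decide, by rw [hfeed]; simp⟩
    · exact absurd rfl ha

end ThreeCyclePocket

/-- **THE UNIFORM 3-CYCLE WITH A SHARED POCKET obeys the ν-uniform shell barrier at EVERY scale ratio**: there is a table of `E₂(4)`,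
orthant, whose live modes `0,1,2` all feed forward (the KP 3-cycle `0 → 1 → 2 → 0`, weights `1/2`) and pump in-shell (weights `1`) into the
dead-end pocket `3`, on which `ShellBarrierAt R ε₀ α` holds for every `R` and EVERY `ε₀ ∈ (0, 1]` (by `sharedPocket_shellBarrierAt` with
`ρ = κ = 2`). [this file] -/
theorem threeCyclePocket_nonempty_shellBarrierAt : ∃ α : Fin 4 → Fin 4 → Fin 4 → ℤ × ℤ × ℤ → ℝ,
    Literature.Analysis.FluidPDE.TaoCascade.InTableClass 4 α ∧
    (∀ (Y : Fin 4 → ℤ → ℝ → ℝ) (τ : ℝ), (∀ (j : Fin 4) (k : ℤ), 1 ≤ k → 0 ≤ Y j k τ) →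
      ∀ δ : ℝ, 0 < δ → ∀ (i : Fin 4) (n : ℤ), 1 ≤ n → Y i n τ = 0 → 0 ≤ quadTerm δ α Y i n τ) ∧
    (∀ a : Fin 4, a ≠ 3 → ∃ e : Fin 4, e ≠ 3 ∧ α a a e (0, 0, 1) ≠ 0) ∧
    ∀ R ε₀ : ℝ, 0 < ε₀ → ε₀ ≤ 1 → ShellBarrierAt R ε₀ α := by
  set α : Fin 4 → Fin 4 → Fin 4 → ℤ × ℤ × ℤ → ℝ := fun i₁ i₂ i₃ μ =>
    if μ = ((0 : ℤ), (0 : ℤ), (1 : ℤ)) then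
      (if i₁ = i₂ ∧ ((i₁ = 0 ∧ i₃ = 1) ∨ (i₁ = 1 ∧ i₃ = 2) ∨ (i₁ = 2 ∧ i₃ = 0)) then (1 / 2 : ℝ) else 0)
    else if μ = ((1 : ℤ), (0 : ℤ), (0 : ℤ)) then
      (if i₂ = i₃ ∧ ((i₂ = 0 ∧ i₁ = 1) ∨ (i₂ = 1 ∧ i₁ = 2) ∨ (i₂ = 2 ∧ i₁ = 0)) then (-(1 / 4) : ℝ) else 0)
    else if μ = ((0 : ℤ), (1 : ℤ), (0 : ℤ)) then
      (if i₁ = i₃ ∧ ((i₁ = 0 ∧ i₂ = 1) ∨ (i₁ = 1 ∧ i₂ = 2) ∨ (i₁ = 2 ∧ i₂ = 0)) then (-(1 / 4) : ℝ) else 0)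
    else if μ = ((0 : ℤ), (0 : ℤ), (0 : ℤ)) then
      ((if i₁ = i₂ ∧ i₁ ≠ 3 ∧ i₃ = 3 then (1 : ℝ) else 0) + (if i₂ = 3 ∧ i₃ = i₁ ∧ i₁ ≠ 3 then -(1 / 2) else 0) +
        (if i₁ = 3 ∧ i₃ = i₂ ∧ i₂ ≠ 3 then -(1 / 2) else 0))
    else 0 with hα
  have hfeed : ∀ i₁ i₂ i₃ : Fin 4, α i₁ i₂ i₃ ((0 : ℤ), (0 : ℤ), (1 : ℤ)) =
      if i₁ = i₂ ∧ ((i₁ = 0 ∧ i₃ = 1) ∨ (i₁ = 1 ∧ i₃ = 2) ∨ (i₁ = 2 ∧ i₃ = 0)) then (1 / 2 : ℝ) else 0 :=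
    fun _ _ _ => by simp [hα]
  have hup1 : ∀ i₁ i₂ i₃ : Fin 4, α i₁ i₂ i₃ ((1 : ℤ), (0 : ℤ), (0 : ℤ)) =
      if i₂ = i₃ ∧ ((i₂ = 0 ∧ i₁ = 1) ∨ (i₂ = 1 ∧ i₁ = 2) ∨ (i₂ = 2 ∧ i₁ = 0)) then (-(1 / 4) : ℝ) else 0 :=
    fun _ _ _ => by simp [hα]
  have hup2 : ∀ i₁ i₂ i₃ : Fin 4, α i₁ i₂ i₃ ((0 : ℤ), (1 : ℤ), (0 : ℤ)) =
      if i₁ = i₃ ∧ ((i₁ = 0 ∧ i₂ = 1) ∨ (i₁ = 1 ∧ i₂ = 2) ∨ (i₁ = 2 ∧ i₂ = 0)) then (-(1 / 4) : ℝ) else 0 :=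
    fun _ _ _ => by simp [hα]
  have hin : ∀ i₁ i₂ i₃ : Fin 4, α i₁ i₂ i₃ ((0 : ℤ), (0 : ℤ), (0 : ℤ)) =
      (if i₁ = i₂ ∧ i₁ ≠ 3 ∧ i₃ = 3 then (1 : ℝ) else 0) + (if i₂ = 3 ∧ i₃ = i₁ ∧ i₁ ≠ 3 then -(1 / 2) else 0) +
        (if i₁ = 3 ∧ i₃ = i₂ ∧ i₂ ≠ 3 then -(1 / 2) else 0) := fun _ _ _ => by simp [hα]
  obtain ⟨hsymm, hcanc⟩ := threeCyclePocket_symmCanc hfeed hup1 hup2 hin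
  obtain ⟨hcomp, -⟩ := threeCyclePocket_comparable hfeed hup1 hup2 hin
  obtain ⟨horth, -⟩ := threeCyclePocket_orthant hfeed hup1 hup2 hin
  obtain ⟨hD, hw3, h3w, hPump, hCz, hρ, hκ, hlive⟩ := threeCyclePocket_classHyps hfeed hin
  refine ⟨α, ⟨hsymm, hcanc, hcomp⟩, horth, hlive, fun R ε₀ hε hε1 => ?_⟩
  exact sharedPocket_shellBarrierAt (P := (![1, 1, 1, 0] : Fin 4 → ℝ)) (ρ := 2) (κ := 2) hε (by norm_num) (by norm_num)
    (fun a => by fin_cases a <;> simp) (by linarith) hρ hκ hD hw3 h3w hPump (by simp) hCz R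

end Summit.NavierStokesRegularity.NavierStokesRegularity.Theorems

end
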